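/-
Copyright: the b2b-balaban cell (near-miss cell 7), T⁴-continuum CRUX team (coordinator ruling e34b3e0c item (2)),
lineage t4-ne7b-formalise-leaf-04 (gen 24). Released under the licence of the surrounding project.
-/
import Summits.QuantumFields.BalabanUV.T4Continuum.Spine.NE7b.HealingMap
import Summits.QuantumFields.BalabanUV.T4Continuum.Support.B16HistoryIndexedFamily

/-!
# The Peierls healing map ON THE CARRIER: junction of route R-H's kernel half (`…NE7b.HealingMap`) with the
# history-indexed term families M1 ∕ M2-A (`B16HistoryIndexedRepr`, `B16HistoryIndexedFamily`)

Cell `pub-balaban`, sub-cell `t4`, spine estimate NE7b (node U5c), candidate route R-H «Peierls healing map» of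
`t4/ROUTES-NE7b.md` v2 (seat `t4-ne7b-idea-1` gen 2), §3: «H1 = `heal` on `HIndex` + the kernel glue ⇒ `bad_left`».
The sibling module `…NE7b.HealingMap` proves the abstract glue (healing inequality, `HealingLaws`,
`relWeightBound_of_healing`, the H2 quotient steps incl. the Fubini forms).  This file plugs it onto the lineage's
carrier (crux node NE7b, route R-P1's (α)-M1∕M2-A, IR-41-1): the END's term sets `T K := HIndex.termSet I K` and
weights `A K t τ := Repr172R.weight μ R t τ = ∫ eterm dμ_K`.

WHAT IS PROVED (kernel; [folklore]; zero `sorry`, nothing of Bałaban's asserted):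
* `RelLinPosOp.apply_le_mul_apply_of_le` — a local bound `F ≤ q·G` on good functions PROPAGATES through a positive
  operation, `TF ≤ q·TG` ((1.73) p. 380 of [Balaban1989LargeFieldII] with a factor; why the operations EXTERIOR to the
  healed component need not be opened — route text H1);
* `HIndex.mem_levelSet_iff`, `HIndex.mk_mem_termSet_iff`, `HIndex.exists_eq_mk_of_mem_termSet` (terms of `T K` are
  the tagged level-`K` choices); the LEVEL-PRESERVING LIFT `HIndex.liftLevel φ` of a per-cutoff map of (outer summand,
  history choice) — the SHAPE of a healing map on the carrier — with `liftLevel_mem_termSet` (H1 (1): lands in `T K`)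
  and `liftLevel_injOn` (H1 (2): injective on a pinned sub-family): the hook on which prediction PH-b «heal is an
  endomorphism of the index family» is decided once M2-B names the components;
* `Repr172R.weight_le_mul_weight` (weight-level H2, pointwise form) and **`Repr172R.weight_le_mul_weight_of_fibre_le`**
  (FIBRE form: split `X K ≃ᵐ E × F` = exterior × the healed component's fibre compatibly with `μ_K`; the quotient
  (0.3) p. 176 of [Balaban1989LargeFieldI] with `Z′ = C`, whole densities, between a bad elementary term and its
  healed one at a.e. frozen exterior, bounds the weights — H3's output is exactly the hypothesis `hfib`);
* **`Repr172R.relWeightBound_weights_of_healing`** — the END: two runs' `HealingLaws` over ONE skeleton's term sets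
  with weights `weight μ RA t` ∕ `weight ν RB t`, `χ ≥ 0`, a common summable majorant `< 1` from `K₀` on ⟹
  `T4WeightBudget.RelWeightBound` — NE7b's output binder, every analytic input of route R-H displayed.

NOT HERE (honest): which `φ` is Bałaban's healing and that it preserves admissibility (H1 as a READING — M2-B∕M4);
the quotient bound H3; the count H4–H6.  BY-NAME EFFECT ON THE WALL (`WALL-NE7b-P1.md` §2): NONE.  NE7b NOT PRINTED,
NOT PROVED; spine PROVED 0∕9; rung (B)+1 on a FINITE torus T⁴ — NOT infinite volume, NOT the mass gap, NOT Clay.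
POLICY (ruling e34b3e0c): crux-route work of item (2), asked by name in ROUTES-NE7b v2 §3; NOT a `T4Continuum/Support`
leaf; no fact minted.
HONEST DEPENDENCY: continuum YM on T⁴ ⇐ BetaPertH ∧ nine spine estimates (0/9 proved); BetaPertH ⇐ (D1) ∧ (D4) ∧
CAP+tail; G-an2-4 gates asym, D1 and NE2/3/4.  This file changes none of it.
-/

set_option autoImplicit false

open Finset MeasureTheory
open Literature.MathematicalPhysics.QuantumFieldTheory.Balaban1983to89

namespace Summit.QuantumFields.BalabanUV.T4Continuum.B16HistoryIndexedRepr

namespace RelLinPosOp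

variable {C : Type*} {𝒢 : GoodClass C}

/-- **A LOCAL QUOTIENT BOUND PROPAGATES THROUGH A POSITIVE OPERATION** ((1.73) with a factor): `F ≤ q·G` on good
`F, G` ⟹ `TF ≤ q·TG` — the reason the operations EXTERIOR to the healed component need not be opened (route text,
H1: «they sit in the exterior integrand, which the quotient never opens»). [folklore] -/
theorem apply_le_mul_apply_of_le (P : RelLinPosOp 𝒢) {F G : C → ℝ} (hF : 𝒢.Gd F) (hG : 𝒢.Gd G) {q : ℝ}
    (h : ∀ y, F y ≤ q * G y) (x : C) : P.T F x ≤ q * P.T G x := by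
  have h1 := P.mono hF (𝒢.smul q hG) h x
  rwa [P.smul hG] at h1

end RelLinPosOp

namespace HIndex

variable {DomK : ℕ → Type*} (I : (K : ℕ) → HIndex (DomK K))

/-- Membership in the level's full index set: `(a, ι) ∈ Σ_a LIdx a ↔ ι ∈ LIdx a`. [folklore] -/
theorem mem_levelSet_iff {K : ℕ} (p : Σ _ : (I K).Adm, (I K).HZ × (I K).HL × (I K).HC) :
    p ∈ levelSet I K ↔ p.2 ∈ (I K).LIdx p.1 := by
  obtain ⟨a, ι⟩ := p
  exact ⟨fun h => (Finset.mem_sigma.mp h).2, fun h => Finset.mem_sigma.mpr ⟨Finset.mem_univ a, h⟩⟩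

/-- Membership in the source-free term set `T K`: the term `(K, (a, ι))` is a term of cutoff `K` iff `(a, ι)` lies in
the level's full index set (iff the history choice `ι` lies in `LIdx a`). [folklore] -/
theorem mk_mem_termSet_iff {K : ℕ} (p : Σ _ : (I K).Adm, (I K).HZ × (I K).HL × (I K).HC) :
    (⟨K, p⟩ : Idx I) ∈ termSet I K ↔ p ∈ levelSet I K := by
  constructor
  · intro h
    obtain ⟨p', hp', hpe⟩ := Finset.mem_map.mp h
    have hpe' : p' = p := eq_of_heq (Sigma.mk.inj_iff.mp hpe).2
    exact hpe' ▸ hp'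
  · intro h
    exact Finset.mem_map.mpr ⟨p, h, rfl⟩

/-- Every term of `T K` is `(K, p)` for some `p` in the level's full index set. [folklore] -/
theorem exists_eq_mk_of_mem_termSet {K : ℕ} {τ : Idx I} (hτ : τ ∈ termSet I K) :
    ∃ p ∈ levelSet I K, τ = ⟨K, p⟩ := by
  obtain ⟨p, hp, rfl⟩ := Finset.mem_map.mp hτ
  exact ⟨p, hp, rfl⟩

/-- **THE LEVEL-PRESERVING LIFT** of a per-cutoff map `φ K` of (outer summand, history choice) to the K-uniform index
type — the shape of a HEALING MAP on the carrier (route R-H, H1: `H ↦ H ∖ C` acts inside one cutoff's index set;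
WHICH `φ` is Bałaban's healing is M2-B's reading, not fixed here). [folklore] -/
def liftLevel (φ : (K : ℕ) → (Σ _ : (I K).Adm, (I K).HZ × (I K).HL × (I K).HC) →
    (Σ _ : (I K).Adm, (I K).HZ × (I K).HL × (I K).HC)) : Idx I → Idx I
  | ⟨K, p⟩ => ⟨K, φ K p⟩

variable {I}

/-- The lift acts inside each cutoff. [folklore] -/
@[simp] theorem liftLevel_mk
    (φ : (K : ℕ) → (Σ _ : (I K).Adm, (I K).HZ × (I K).HL × (I K).HC) →
      (Σ _ : (I K).Adm, (I K).HZ × (I K).HL × (I K).HC))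
    (K : ℕ) (p : Σ _ : (I K).Adm, (I K).HZ × (I K).HL × (I K).HC) :
    liftLevel I φ ⟨K, p⟩ = ⟨K, φ K p⟩ := rfl

/-- H1 (1) transported (`HealingLaws.heal_mem`): if `φ K` sends the choice `p` into the level's full index set, the
lift sends the term `(K, p)` into `T K`. [folklore] -/
theorem liftLevel_mem_termSet
    {φ : (K : ℕ) → (Σ _ : (I K).Adm, (I K).HZ × (I K).HL × (I K).HC) →
      (Σ _ : (I K).Adm, (I K).HZ × (I K).HL × (I K).HC)}
    {K : ℕ} {p : Σ _ : (I K).Adm, (I K).HZ × (I K).HL × (I K).HC} (hcl : φ K p ∈ levelSet I K) :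
    liftLevel I φ ⟨K, p⟩ ∈ termSet I K :=
  (mk_mem_termSet_iff I (φ K p)).mpr hcl

/-- H1 (2) transported (`HealingLaws.heal_injOn`): on a family `S` of terms of cutoff `K`, injectivity of `φ K` on the
underlying choices gives injectivity of the lift. [folklore] -/
theorem liftLevel_injOn
    {φ : (K : ℕ) → (Σ _ : (I K).Adm, (I K).HZ × (I K).HL × (I K).HC) →
      (Σ _ : (I K).Adm, (I K).HZ × (I K).HL × (I K).HC)}
    {K : ℕ} {S : Finset (Idx I)} (hS : S ⊆ termSet I K)
    (hinj : ∀ p p', (⟨K, p⟩ : Idx I) ∈ S → (⟨K, p'⟩ : Idx I) ∈ S → φ K p = φ K p' → p = p') :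
    Set.InjOn (liftLevel I φ) ↑S := by
  intro τ hτ τ' hτ' h
  obtain ⟨p, -, rfl⟩ := exists_eq_mk_of_mem_termSet I (hS (Finset.mem_coe.mp hτ))
  obtain ⟨p', -, rfl⟩ := exists_eq_mk_of_mem_termSet I (hS (Finset.mem_coe.mp hτ'))
  have h' : φ K p = φ K p' := eq_of_heq (Sigma.mk.inj_iff.mp h).2
  rw [hinj p p' (Finset.mem_coe.mp hτ) (Finset.mem_coe.mp hτ') h']

end HIndex

namespace Repr172R

variable {DomK : ℕ → Type*} {I : (K : ℕ) → HIndex (DomK K)} {X : ℕ → Type*} [∀ K, MeasurableSpace (X K)]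
  {𝒢 : (K : ℕ) → GoodClass (X K)}

/-- **H2 AT THE WEIGHT LEVEL**: an a.e. bound `eterm a ι ≤ q · eterm a' ι'` between two elementary terms of the SAME
cutoff (the bad term and its healed term, after the fibre comparison), the healed one integrable, `χ_a ≥ 0` ⟹
`A K t (K,a,ι) ≤ q · A K t (K,a',ι')`. [folklore] -/
theorem weight_le_mul_weight (μ : (K : ℕ) → Measure (X K)) (R : (K : ℕ) → ℝ → Repr172R (𝒢 K) (I K)) (t : ℝ)
    {K : ℕ} {a a' : (I K).Adm} {ι ι' : (I K).HZ × (I K).HL × (I K).HC} {q : ℝ}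
    (hχ : ∀ V, 0 ≤ (R K t).χ a V) (hint : Integrable ((R K t).eterm a' ι') (μ K))
    (hle : ∀ᵐ x ∂(μ K), (R K t).eterm a ι x ≤ q * (R K t).eterm a' ι' x) :
    weight μ R t ⟨K, a, ι⟩ ≤ q * weight μ R t ⟨K, a', ι'⟩ :=
  NE7b.HealingMap.integral_le_mul_integral_of_le
    (Filter.Eventually.of_forall fun x => (R K t).eterm_nonneg a ι hχ x) hint hle

/-- **H2 AT THE WEIGHT LEVEL, FIBRE FORM — the quotient (0.3) on the carrier**: split the cutoff-`K` configuration
space `X K ≃ᵐ E × F` (exterior × the healed component's fibre) compatibly with the reference measure; if for a.e.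
frozen exterior field the FIBRE INTEGRAL of the bad elementary term is at most `q` times that of the healed term
(numerator∕denominator of (0.3) with `Z′ = C`, whole densities — H3's output), both terms integrable, `χ_a ≥ 0`, then
`A K t (K,a,ι) ≤ q · A K t (K,a',ι')`. [folklore] -/
theorem weight_le_mul_weight_of_fibre_le (μ : (K : ℕ) → Measure (X K))
    (R : (K : ℕ) → ℝ → Repr172R (𝒢 K) (I K)) (t : ℝ) {K : ℕ}
    {E F : Type*} [MeasurableSpace E] [MeasurableSpace F] {μE : Measure E} {μF : Measure F}
    [SFinite μE] [SFinite μF] (e : X K ≃ᵐ E × F) (hμ : (μ K).map e = μE.prod μF)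
    {a a' : (I K).Adm} {ι ι' : (I K).HZ × (I K).HL × (I K).HC} {q : ℝ}
    (hχ : ∀ V, 0 ≤ (R K t).χ a V) (hintB : Integrable ((R K t).eterm a ι) (μ K))
    (hintH : Integrable ((R K t).eterm a' ι') (μ K))
    (hfib : ∀ᵐ x ∂μE, ∫ f, (R K t).eterm a ι (e.symm (x, f)) ∂μF ≤
      q * ∫ f, (R K t).eterm a' ι' (e.symm (x, f)) ∂μF) :
    weight μ R t ⟨K, a, ι⟩ ≤ q * weight μ R t ⟨K, a', ι'⟩ :=
  NE7b.HealingMap.integral_le_mul_integral_of_fibre_le_split e hμ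
    (fun x => (R K t).eterm_nonneg a ι hχ x) hintB hintH hfib

/-- **THE END OVER THE CARRIER**: healing laws for run A's weights `A K t := weight μ RA t` and run B's
`B K t := weight ν RB t` over the source-free term sets `T K := termSet I K` of ONE skeleton (M2-A), characteristic
functions `≥ 0` (so all weights are `≥ 0`, `weight_nonneg`), and a common summable majorant `< 1` from `K₀` on ⟹
`T4WeightBudget.RelWeightBound` for the two term families — the binder NE7b's consumers take, with every analytic
input of route R-H displayed. [folklore] -/
theorem relWeightBound_weights_of_healing {Y : ℕ → Type*} [∀ K, MeasurableSpace (Y K)]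
    {𝒢' : (K : ℕ) → GoodClass (Y K)} (μ : (K : ℕ) → Measure (X K)) (ν : (K : ℕ) → Measure (Y K))
    (RA : (K : ℕ) → ℝ → Repr172R (𝒢 K) (I K)) (RB : (K : ℕ) → ℝ → Repr172R (𝒢' K) (I K))
    {l₀ : ℝ} {Bad : ℕ → ℝ → Finset (HIndex.Idx I)} {α α' : Type*}
    {XA : ℕ → Finset α} {BadxA : ℕ → α → Finset (HIndex.Idx I)} {healA : ℕ → α → HIndex.Idx I → HIndex.Idx I}
    {qA : ℕ → α → ℝ} {XB : ℕ → Finset α'} {BadxB : ℕ → α' → Finset (HIndex.Idx I)}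
    {healB : ℕ → α' → HIndex.Idx I → HIndex.Idx I} {qB : ℕ → α' → ℝ} {K₀ : ℕ} {W : ℕ → ℝ}
    (hA : NE7b.HealingMap.HealingLaws l₀ (HIndex.termSet I) (fun _ t => weight μ RA t) Bad XA BadxA healA qA)
    (hB : NE7b.HealingMap.HealingLaws l₀ (HIndex.termSet I) (fun _ t => weight ν RB t) Bad XB BadxB healB qB)
    (hχA : ∀ K t a V, 0 ≤ (RA K t).χ a V) (hχB : ∀ K t a V, 0 ≤ (RB K t).χ a V)
    (hWA : ∀ K, K₀ ≤ K → ∑ x ∈ XA K, qA K x ≤ W K) (hWB : ∀ K, K₀ ≤ K → ∑ x ∈ XB K, qB K x ≤ W K)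
    (h1 : ∀ K, K₀ ≤ K → W K < 1) (hs : Summable W) :
    T4WeightBudget.RelWeightBound l₀ (HIndex.termSet I) (fun _ t => weight μ RA t) (fun _ t => weight ν RB t)
      (fun K t => if K₀ ≤ K then Bad K t else ∅) (Set.indicator {K | K₀ ≤ K} W) :=
  NE7b.HealingMap.relWeightBound_of_healing hA hB
    (fun _ t _ τ => weight_nonneg μ RA t (fun K a V => hχA K t a V) τ)
    (fun _ t _ τ => weight_nonneg ν RB t (fun K a V => hχB K t a V) τ) hWA hWB h1 hs

end Repr172R

end Summit.QuantumFields.BalabanUV.T4Continuum.B16HistoryIndexedRepr
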